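import Literature.Geometry.Kaehler.TorusDolbeaultLaplacian
import Literature.NumberTheory.Transcendental.KaehlerHodgeLaplacianDProofs
import Literature.NumberTheory.Transcendental.KaehlerHodgeLaplacianProofs
import HarnessLib

/-!
# The torus Laplacian agrees with `Δ_∂̄` on forms supported in the chart (Warner 6.31)

F. W. Warner, GTM 94 (1983), 6.31: "there exists a periodic elliptic operator `L̃` which agrees
with `L` on `O₀`". For the torus `∂̄`-Laplacian of `TorusDolbeaultLaplacian` and a smooth complex
`(k+1)`-form `β` supported in the chart preimage of the inner cube region:

  `𝓕(T(Δ_∂̄ β)) = L̃ (𝓕(T β))`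

(`mFourierCoeff_toTorus_dolbeaultLaplacian`; also the degree-`0` and top-degree cases), from the
agreement of the transferred `∂̄`, `∂̄*` (`ChartOp1.Represents.toTorus_apply` with
`represents_dolbeaultBar`, `represents_dolbeaultBarAdjoint`), support preservation
(`ChartOp1.Represents.support_subset`) and the torus dictionary (`Torus.mFourierCoeff_laplaceLike`).

## References

* F. W. Warner, GTM 94 (1983), 6.31, 6.32. [WarnerGTM94]
-/

noncomputable section

open scoped Manifold ContDiff Topology
open Bundle Set Function Module Metric Complex UnitAddTorus
open Literature.Analysis.FunctionSpaces Literature.Analysis.FunctionSpaces.Torus Literature.NumberTheory.Transcendental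

set_option maxSynthPendingDepth 2

namespace Literature.Geometry.Kaehler

variable {E : Type*} [NormedAddCommGroup E] [NormedSpace ℂ E] [FiniteDimensional ℂ E]
  {n : ℕ} [Fact (finrank ℝ E = n)]
  {M : Type*} [TopologicalSpace M] [ChartedSpace E M] [T2Space M] [IsManifold 𝓘(ℂ, E) ω M]
  [IsManifold 𝓘(ℝ, E) ∞ M]
  [RiemannianBundle (fun x : M ↦ TangentSpace 𝓘(ℝ, E) x)]
  [IsContMDiffRiemannianBundle 𝓘(ℝ, E) ∞ E (fun x : M ↦ TangentSpace 𝓘(ℝ, E) x)]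
  (o : (x : M) → Orientation ℝ (TangentSpace 𝓘(ℝ, E) x) (Fin n)) {k m : ℕ}
  {p : M} {A : E ≃L[ℝ] EuclideanSpace ℝ (Fin n)}

/-- The real-linear fibre identification used by the transfer. [folklore] -/
abbrev fibreIsoℝ (E : Type*) [NormedAddCommGroup E] [NormedSpace ℂ E] [FiniteDimensional ℂ E] (j : ℕ) :
    (E [⋀^Fin j]→L[ℝ] ℂ) →L[ℝ] EuclideanSpace ℂ (Fin (fibreDim E j)) :=
  ((fibreIso E j : (E [⋀^Fin j]→L[ℝ] ℂ) →L[ℂ] EuclideanSpace ℂ (Fin (fibreDim E j))).restrictScalars ℝ)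

omit [FiniteDimensional ℂ E] [Fact (finrank ℝ E = n)] [RiemannianBundle (fun x : M ↦ TangentSpace 𝓘(ℝ, E) x)]
  [IsContMDiffRiemannianBundle 𝓘(ℝ, E) ∞ E (fun x : M ↦ TangentSpace 𝓘(ℝ, E) x)] in
/-- `∂̄` preserves chart supports in the inner cube region. [folklore] -/
theorem support_dolbeaultBar_subset (𝒞 : CubeCutoff p A) {β : MForm 𝓘(ℝ, E) M ℂ k} (hβ : IsSmoothForm β)
    (hK : ∀ x, β x ≠ 0 → x ∈ (extChartAt 𝓘(ℝ, E) p).source ∧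
      extChartAt 𝓘(ℝ, E) p x ∈ cubeRegion A (extChartAt 𝓘(ℝ, E) p p) 𝒞.ρ) :
    ∀ x, dolbeaultBar β x ≠ 0 → x ∈ (extChartAt 𝓘(ℝ, E) p).source ∧
      extChartAt 𝓘(ℝ, E) p x ∈ cubeRegion A (extChartAt 𝓘(ℝ, E) p p) 𝒞.ρ :=
  ChartOp1.Represents.support_subset (fun p' ↦ represents_dolbeaultBar (k := k) p') hβ (isCompact_cubeRegion _)
    (𝒞.region_mono.trans 𝒞.region_subset) hK

/-- `∂̄*` preserves chart supports in the inner cube region. [folklore] -/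
theorem support_dolbeaultBarAdjoint_subset (ho : IsSmoothForm (riemannianVolumeForm o)) (h : (k + 1) + m = n)
    (𝒞 : CubeCutoff p A) {β : MForm 𝓘(ℝ, E) M ℂ (k + 1)} (hβ : IsSmoothForm β)
    (hK : ∀ x, β x ≠ 0 → x ∈ (extChartAt 𝓘(ℝ, E) p).source ∧
      extChartAt 𝓘(ℝ, E) p x ∈ cubeRegion A (extChartAt 𝓘(ℝ, E) p p) 𝒞.ρ) :
    ∀ x, dolbeaultBarAdjoint o h β x ≠ 0 → x ∈ (extChartAt 𝓘(ℝ, E) p).source ∧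
      extChartAt 𝓘(ℝ, E) p x ∈ cubeRegion A (extChartAt 𝓘(ℝ, E) p p) 𝒞.ρ :=
  ChartOp1.Represents.support_subset (fun p' ↦ represents_dolbeaultBarAdjoint o ho h p') hβ
    (isCompact_cubeRegion _) (𝒞.region_mono.trans 𝒞.region_subset) hK

omit [Fact (finrank ℝ E = n)] [RiemannianBundle (fun x : M ↦ TangentSpace 𝓘(ℝ, E) x)]
  [IsContMDiffRiemannianBundle 𝓘(ℝ, E) ∞ E (fun x : M ↦ TangentSpace 𝓘(ℝ, E) x)] in
/-- **Agreement for `∂̄`**: `T(∂̄β) = ∂̄̃ (Tβ)`. [cite: WarnerGTM94, 6.31] -/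
theorem toTorus_dolbeaultBar (𝒞 : CubeCutoff p A) {β : MForm 𝓘(ℝ, E) M ℂ k} (hβ : IsSmoothForm β)
    (hK : ∀ x, β x ≠ 0 → x ∈ (extChartAt 𝓘(ℝ, E) p).source ∧
      extChartAt 𝓘(ℝ, E) p x ∈ cubeRegion A (extChartAt 𝓘(ℝ, E) p p) 𝒞.ρ) :
    MForm.toTorus p A (fibreIsoℝ E (k + 1)) (dolbeaultBar β) =
      (torusDolbeaultBar k 𝒞).apply (MForm.toTorus p A (fibreIsoℝ E k) β) :=
  ChartOp1.Represents.toTorus_apply 𝒞 _ _ _ (represents_dolbeaultBar p)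
    (fun _ hβ hK ↦ support_dolbeaultBar_subset 𝒞 hβ hK) hβ hK

/-- **Agreement for `∂̄*`**: `T(∂̄*β) = ∂̄*̃ (Tβ)`. [cite: WarnerGTM94, 6.31] -/
theorem toTorus_dolbeaultBarAdjoint (ho : IsSmoothForm (riemannianVolumeForm o)) (h : (k + 1) + m = n)
    (𝒞 : CubeCutoff p A) {β : MForm 𝓘(ℝ, E) M ℂ (k + 1)} (hβ : IsSmoothForm β)
    (hK : ∀ x, β x ≠ 0 → x ∈ (extChartAt 𝓘(ℝ, E) p).source ∧
      extChartAt 𝓘(ℝ, E) p x ∈ cubeRegion A (extChartAt 𝓘(ℝ, E) p p) 𝒞.ρ) :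
    MForm.toTorus p A (fibreIsoℝ E k) (dolbeaultBarAdjoint o h β) =
      (torusDolbeaultBarAdjoint o ho h 𝒞).apply (MForm.toTorus p A (fibreIsoℝ E (k + 1)) β) :=
  ChartOp1.Represents.toTorus_apply 𝒞 _ _ _ (represents_dolbeaultBarAdjoint o ho h p)
    (fun _ hβ hK ↦ support_dolbeaultBarAdjoint_subset o ho h 𝒞 hβ hK) hβ hK

/-- **Agreement for `Δ_∂̄` (generic degree `(k+1) + (m+1) = n`)**: `𝓕(T(Δ_∂̄ β)) = L̃ 𝓕(Tβ)`.
[cite: WarnerGTM94, 6.31] -/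
theorem mFourierCoeff_toTorus_dolbeaultLaplacian (ho : IsSmoothForm (riemannianVolumeForm o))
    (h : (k + 1) + (m + 1) = n) (𝒞 : CubeCutoff p A) {β : MForm 𝓘(ℝ, E) M ℂ (k + 1)} (hβ : IsSmoothForm β)
    (hK : ∀ x, β x ≠ 0 → x ∈ (extChartAt 𝓘(ℝ, E) p).source ∧
      extChartAt 𝓘(ℝ, E) p x ∈ cubeRegion A (extChartAt 𝓘(ℝ, E) p p) 𝒞.ρ) :
    mFourierCoeff (MForm.toTorus p A (fibreIsoℝ E (k + 1)) (dolbeaultLaplacian o (k + 1) (m + 1) h β)) =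
      (torusLaplacian o ho h (show (k + 1 + 1) + m = n by omega) 𝒞).apply
        (mFourierCoeff (MForm.toTorus p A (fibreIsoℝ E (k + 1)) β)) := by
  have hg : Torus.IsSmooth (MForm.toTorus p A (fibreIsoℝ E (k + 1)) β) :=
    MForm.isSmooth_toTorus _ 𝒞.ρ_lt_half hβ (𝒞.region_mono.trans 𝒞.region_subset) hK
  have h1 : dolbeaultLaplacian o (k + 1) (m + 1) h β =
      dolbeaultBar (dolbeaultBarAdjoint o h β) +
        dolbeaultBarAdjoint o (show (k + 1 + 1) + m = n by omega) (dolbeaultBar β) := rfl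
  rw [h1, MForm.toTorus_add, toTorus_dolbeaultBar 𝒞 (IsSmoothForm.dolbeaultBarAdjoint o ho h hβ)
      (support_dolbeaultBarAdjoint_subset o ho h 𝒞 hβ hK),
    toTorus_dolbeaultBarAdjoint o ho h 𝒞 hβ hK,
    toTorus_dolbeaultBarAdjoint o ho _ 𝒞 hβ.dolbeaultBar (support_dolbeaultBar_subset 𝒞 hβ hK),
    toTorus_dolbeaultBar 𝒞 hβ hK, torusLaplacian]
  exact Torus.mFourierCoeff_laplaceLike _ _ _ _ hg

/-- Agreement in degree `0` (`Δ_∂̄ = ∂̄*∂̄`, `0 + (m+1) = n`). [cite: WarnerGTM94, 6.31] -/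
theorem mFourierCoeff_toTorus_dolbeaultLaplacian_zero (ho : IsSmoothForm (riemannianVolumeForm o))
    (h : 0 + (m + 1) = n) (𝒞 : CubeCutoff p A) {β : MForm 𝓘(ℝ, E) M ℂ 0} (hβ : IsSmoothForm β)
    (hK : ∀ x, β x ≠ 0 → x ∈ (extChartAt 𝓘(ℝ, E) p).source ∧
      extChartAt 𝓘(ℝ, E) p x ∈ cubeRegion A (extChartAt 𝓘(ℝ, E) p p) 𝒞.ρ) :
    mFourierCoeff (MForm.toTorus p A (fibreIsoℝ E 0) (dolbeaultLaplacian o 0 (m + 1) h β)) =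
      (torusLaplacianZero o ho (show (0 + 1) + m = n by omega) 𝒞).apply
        (mFourierCoeff (MForm.toTorus p A (fibreIsoℝ E 0) β)) := by
  have hg : Torus.IsSmooth (MForm.toTorus p A (fibreIsoℝ E 0) β) :=
    MForm.isSmooth_toTorus _ 𝒞.ρ_lt_half hβ (𝒞.region_mono.trans 𝒞.region_subset) hK
  have h1 : dolbeaultLaplacian o 0 (m + 1) h β =
      dolbeaultBarAdjoint o (show (0 + 1) + m = n by omega) (dolbeaultBar β) := rfl
  rw [h1, toTorus_dolbeaultBarAdjoint o ho _ 𝒞 hβ.dolbeaultBar (support_dolbeaultBar_subset 𝒞 hβ hK),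
    toTorus_dolbeaultBar 𝒞 hβ hK, torusLaplacianZero]
  exact Torus.FOp1.mFourierCoeff_apply_apply _ _ hg

/-- Agreement in top degree (`Δ_∂̄ = ∂̄∂̄*`, `(k+1) + 0 = n`). [cite: WarnerGTM94, 6.31] -/
theorem mFourierCoeff_toTorus_dolbeaultLaplacian_top (ho : IsSmoothForm (riemannianVolumeForm o))
    (h : (k + 1) + 0 = n) (𝒞 : CubeCutoff p A) {β : MForm 𝓘(ℝ, E) M ℂ (k + 1)} (hβ : IsSmoothForm β)
    (hK : ∀ x, β x ≠ 0 → x ∈ (extChartAt 𝓘(ℝ, E) p).source ∧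
      extChartAt 𝓘(ℝ, E) p x ∈ cubeRegion A (extChartAt 𝓘(ℝ, E) p p) 𝒞.ρ) :
    mFourierCoeff (MForm.toTorus p A (fibreIsoℝ E (k + 1)) (dolbeaultLaplacian o (k + 1) 0 h β)) =
      (torusLaplacianTop o ho h 𝒞).apply (mFourierCoeff (MForm.toTorus p A (fibreIsoℝ E (k + 1)) β)) := by
  have hg : Torus.IsSmooth (MForm.toTorus p A (fibreIsoℝ E (k + 1)) β) :=
    MForm.isSmooth_toTorus _ 𝒞.ρ_lt_half hβ (𝒞.region_mono.trans 𝒞.region_subset) hK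
  have h1 : dolbeaultLaplacian o (k + 1) 0 h β = dolbeaultBar (dolbeaultBarAdjoint o h β) := rfl
  rw [h1, toTorus_dolbeaultBar 𝒞 (IsSmoothForm.dolbeaultBarAdjoint o ho h hβ) (support_dolbeaultBarAdjoint_subset o ho h 𝒞 hβ hK),
    toTorus_dolbeaultBarAdjoint o ho h 𝒞 hβ hK, torusLaplacianTop]
  exact Torus.FOp1.mFourierCoeff_apply_apply _ _ hg

end Literature.Geometry.Kaehler
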